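import Mathlib.Data.Nat.Choose.Central
import Mathlib.Algebra.BigOperators.Group.Finset.Basic
import Mathlib.Tactic
import Summits.KontsevichZagierPeriods.Zeta5Search.DexactDiagonalWhipple
import Summits.KontsevichZagierPeriods.Zeta5Search.DexactDiagonalK1Rec
import HarnessLib

/-!
# ζ(5) search — CONJECTURE D-exact on the diagonal: the single-sum identity PROVED, K1 certificate replay (2/2) (cell `pub-zeta5`, P2 g6)

HONEST FRAMING: systematic search; no irrationality claim unless certified.  Identities between finite binomial sums of natural
numbers; nothing about the arithmetic of ζ(5); no record moves.

`Zeta5Search/DexactDiagonalWhipple.lean` (fam-tele g10) reduced `Fdiag n = Q n` — CONJECTURE D-exact of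
`Families/DualConstantTerm.lean` (P2 g6) on the diagonal, in its double-sum form — to ONE single-sum identity
`SingleSumIdentity : C(n+k,n)·S_A(n,k) = C(n,k)·S_B(n,k)` (`0 ≤ k ≤ n`), proved there on paper by Whipple's ₄F₃ transformation
[AndrewsAskeyRoy1999, Thm 3.3.3].  This file finishes the Whipple-free KERNEL proof begun in `DexactDiagonalK1Rec.lean`
(common `k`-recurrence of `U = C(n+k,n)S_A` and `V = C(n,k)S_B`, free zeros at `k = n+1, n+2`):

* the anchor `V(n,n) = D(n) = Σ_j C(n,j)²C(n+j,j)C(2n+j,n+j) = C(2n,n)³`: certificate (C3) of fam-tele's package gives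
  `(n+1)³D(n+1) = 8(2n+1)³D(n)` (`dSum_rec`), whence `dSum_eq` (classically Pfaff–Saalschütz); `innerT_diag : T(n,n) = D(n)`;
* downward induction on `k` from the free zeros with `p₀ ≠ 0` below the diagonal: **`uSum_eq_vVal`** (`U = V`, `k ≤ n`, `n ≥ 1`);
* back to the tree's `SA`/`SB` (`uSum_eq_SA`, `vVal_eq_SB`) ⇒ **`singleSumIdentity_holds : SingleSumIdentity`** and hence
  **`Fdiag_eq_Q : ∀ n, Fdiag n = Q n`** UNCONDITIONALLY (fam-tele's `Fdiag_eq_of_singleSum`).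

What this does NOT do: the coefficient-extraction step `dualConstantTerm (n,…,n) = Fdiag n` (cert-2's `DualCT` machinery) —
with it, D-exact on the whole diagonal is a kernel theorem; off the diagonal D-exact stays a CONJECTURE.  Standard axioms only.
-/

namespace Summit.KontsevichZagierPeriods.Zeta5Search.DexactDiagonalWhipple

open Finset
open Literature.NumberTheory.Irrationality.BrownZudilin2022 (Q)
open Summit.KontsevichZagierPeriods.Zeta5Search.SymmetricRecursion
  (innerTerm innerT innerTerm_succ_self e₁ relK choose_succ_left_cast choose_succ_right_cast)

/-! ### The anchor `D(n) = Σ_j C(n,j)²C(n+j,j)C(2n+j,n+j) = C(2n,n)³` (certificate C3) -/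

/-- `d(n,j) = C(n,j)²·C(n+j,j)·C(2n+j,n+j)`. -/
def dTerm (n j : ℕ) : ℚ :=
  ((n.choose j : ℕ) : ℚ) ^ 2 * (((n + j).choose j : ℕ) : ℚ) * (((2 * n + j).choose (n + j) : ℕ) : ℚ)

/-- `D(n) = Σ_{j ≤ n} d(n,j)`. -/
def dSum (n : ℕ) : ℚ := ∑ j ∈ range (n + 1), dTerm n j

/-- Shift in `n`: `d(n,j)·(2n+j+1)(2n+j+2) = d(n+1,j)·(n+1−j)²` (all `n, j`). -/
theorem dTerm_n_succ (n j : ℕ) :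
    dTerm n j * ((2 * (n : ℚ) + j + 1) * (2 * (n : ℚ) + j + 2)) = dTerm (n + 1) j * ((n : ℚ) + 1 - j) ^ 2 := by
  have eb := choose_succ_left_cast n j
  have ec := choose_succ_left_cast (n + j) j
  have hd1 : ((((2 * n + j) : ℕ) : ℚ) + 1) * (((2 * n + j).choose (n + j) : ℕ) : ℚ) =
      (((2 * n + j + 1).choose (n + j + 1) : ℕ) : ℚ) * (((n + j : ℕ) : ℚ) + 1) := by
    exact_mod_cast Nat.add_one_mul_choose_eq (2 * n + j) (n + j)
  have hd2 := choose_succ_left_cast (2 * n + j + 1) (n + j + 1)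
  have hF : ((n : ℚ) + 1) ^ 2 * ((n : ℚ) + j + 1) ≠ 0 := by positivity
  unfold dTerm
  rw [show n + 1 + j = n + j + 1 by ring, show 2 * (n + 1) + j = 2 * n + j + 1 + 1 by ring]
  push_cast at eb ec hd1 hd2 ⊢
  set b := ((n.choose j : ℕ) : ℚ)
  set b' := (((n + 1).choose j : ℕ) : ℚ)
  set c := (((n + j).choose j : ℕ) : ℚ)
  set c' := (((n + j + 1).choose j : ℕ) : ℚ)
  set d := (((2 * n + j).choose (n + j) : ℕ) : ℚ)
  set d' := (((2 * n + j + 1).choose (n + j + 1) : ℕ) : ℚ)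
  set d'' := (((2 * n + j + 1 + 1).choose (n + j + 1) : ℕ) : ℚ)
  apply mul_right_cancel₀ hF
  linear_combination (-((b' * ((n : ℚ) + 1 - j) + b * ((n : ℚ) + 1)) * (c' * ((n : ℚ) + 1)) *
      (d'' * ((n : ℚ) + 1)) * ((n : ℚ) + j + 1))) * eb +
    (-((b * ((n : ℚ) + 1)) ^ 2 * (d'' * ((n : ℚ) + 1)) * ((n : ℚ) + j + 1))) * ec +
    (-((b * ((n : ℚ) + 1)) ^ 2 * (c * ((n : ℚ) + j + 1)) * ((n : ℚ) + j + 1))) * hd2 +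
    ((b * ((n : ℚ) + 1)) ^ 2 * c * (2 * (n : ℚ) + j + 2) * ((n : ℚ) + j + 1)) * hd1

/-- Shift in `j`: `d(m,j+1)·(j+1)³ = d(m,j)·(m−j)²(2m+j+1)` (all `m, j`). -/
theorem dTerm_j_succ (m j : ℕ) :
    dTerm m (j + 1) * ((j : ℚ) + 1) ^ 3 = dTerm m j * (((m : ℚ) - j) ^ 2 * (2 * (m : ℚ) + j + 1)) := by
  have hb := choose_succ_right_cast m j
  have hc : ((((m + j) : ℕ) : ℚ) + 1) * (((m + j).choose j : ℕ) : ℚ) =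
      (((m + j + 1).choose (j + 1) : ℕ) : ℚ) * ((j : ℚ) + 1) := by
    exact_mod_cast Nat.add_one_mul_choose_eq (m + j) j
  have hd : ((((2 * m + j) : ℕ) : ℚ) + 1) * (((2 * m + j).choose (m + j) : ℕ) : ℚ) =
      (((2 * m + j + 1).choose (m + j + 1) : ℕ) : ℚ) * (((m + j : ℕ) : ℚ) + 1) := by
    exact_mod_cast Nat.add_one_mul_choose_eq (2 * m + j) (m + j)
  have hF : ((m : ℚ) + j + 1) ≠ 0 := by positivity
  unfold dTerm
  rw [show m + (j + 1) = m + j + 1 by ring, show 2 * m + (j + 1) = 2 * m + j + 1 by ring]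
  push_cast at hb hc hd ⊢
  set b := ((m.choose j : ℕ) : ℚ)
  set b' := ((m.choose (j + 1) : ℕ) : ℚ)
  set c := (((m + j).choose j : ℕ) : ℚ)
  set c' := (((m + j + 1).choose (j + 1) : ℕ) : ℚ)
  set d := (((2 * m + j).choose (m + j) : ℕ) : ℚ)
  set d' := (((2 * m + j + 1).choose (m + j + 1) : ℕ) : ℚ)
  apply mul_right_cancel₀ hF
  linear_combination ((b' * ((j : ℚ) + 1) + b * ((m : ℚ) - j)) * (c' * ((j : ℚ) + 1)) * (d' * ((m : ℚ) + j + 1))) * hb -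
    ((b * ((m : ℚ) - j)) ^ 2 * (d' * ((m : ℚ) + j + 1))) * hc -
    ((b * ((m : ℚ) - j)) ^ 2 * (c * ((m : ℚ) + j + 1))) * hd

/-- Certificate of (C3), in the pole-free normalisation `G_D(n,j) = j³(21jn+13j−30n²−49n−19)/((2n+j+1)(2n+j+2)) · d(n+1,j)`. -/
def certD (n j : ℕ) : ℚ :=
  (j : ℚ) ^ 3 * (21 * (j : ℚ) * n + 13 * j - 30 * (n : ℚ) ^ 2 - 49 * n - 19) /
    ((2 * (n : ℚ) + j + 1) * (2 * (n : ℚ) + j + 2)) * dTerm (n + 1) j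

set_option maxRecDepth 100000 in
/-- Termwise form of (C3): `−8(2n+1)³d(n,j) + (n+1)³d(n+1,j) = G_D(j+1) − G_D(j)`. -/
theorem certD_term (n j : ℕ) :
    -8 * (2 * (n : ℚ) + 1) ^ 3 * dTerm n j + ((n : ℚ) + 1) ^ 3 * dTerm (n + 1) j = certD n (j + 1) - certD n j := by
  have hD4 : ((2 * (n : ℚ) + j + 1) * (2 * (n : ℚ) + j + 2)) ≠ 0 := by positivity
  have hD5 : ((j : ℚ) + 1) ^ 3 ≠ 0 := by positivity
  have r4 : dTerm n j = dTerm (n + 1) j * (((n : ℚ) + 1 - j) ^ 2 / ((2 * (n : ℚ) + j + 1) * (2 * (n : ℚ) + j + 2))) := by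
    rw [mul_div_assoc', eq_div_iff hD4]; exact dTerm_n_succ n j
  have r5 : dTerm (n + 1) (j + 1) = dTerm (n + 1) j *
      (((((n + 1 : ℕ) : ℚ)) - j) ^ 2 * (2 * (((n + 1 : ℕ) : ℚ)) + j + 1) / ((j : ℚ) + 1) ^ 3) := by
    rw [mul_div_assoc', eq_div_iff hD5]; exact dTerm_j_succ (n + 1) j
  unfold certD
  rw [r5, r4]
  push_cast
  have h1 : (2 * (n : ℚ) + j + 1) ≠ 0 := by positivity
  have h2 : (2 * (n : ℚ) + j + 2) ≠ 0 := by positivity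
  have h3 : (2 * (n : ℚ) + (j + 1) + 1) ≠ 0 := by positivity
  have h4 : (2 * (n : ℚ) + (j + 1) + 2) ≠ 0 := by positivity
  have h5 : ((j : ℚ) + 1) ≠ 0 := by positivity
  field_simp
  ring

/-- `d(n,n+1) = 0` and `d(n+1,n+2) = 0`. -/
theorem dTerm_succ_self (n : ℕ) : dTerm n (n + 1) = 0 := by
  simp [dTerm, Nat.choose_succ_self]

/-- **Recurrence for `D`** (certificate C3 summed over `j ≤ n+1`): `(n+1)³D(n+1) = 8(2n+1)³D(n)`. -/
theorem dSum_rec (n : ℕ) : ((n : ℚ) + 1) ^ 3 * dSum (n + 1) = 8 * (2 * (n : ℚ) + 1) ^ 3 * dSum n := by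
  have hsum : -8 * (2 * (n : ℚ) + 1) ^ 3 * (∑ j ∈ range (n + 2), dTerm n j) + ((n : ℚ) + 1) ^ 3 * dSum (n + 1)
      = ∑ j ∈ range (n + 2), (certD n (j + 1) - certD n j) := by
    unfold dSum
    rw [Finset.mul_sum, Finset.mul_sum, ← Finset.sum_add_distrib]
    exact Finset.sum_congr rfl fun j _ => certD_term n j
  rw [Finset.sum_range_sub, Finset.sum_range_succ, dTerm_succ_self, add_zero] at hsum
  have h0 : certD n 0 = 0 := by simp [certD]
  have htop : certD n (n + 2) = 0 := by
    rw [certD, show n + 2 = (n + 1) + 1 by ring, dTerm_succ_self]; simp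
  rw [h0, htop, sub_zero] at hsum
  unfold dSum at hsum ⊢
  linarith

/-- **The anchor sum**: `D(n) = Σ_{j ≤ n} C(n,j)²C(n+j,j)C(2n+j,n+j) = C(2n,n)³`
(classically Pfaff–Saalschütz; here from `dSum_rec` and `(n+1)C(2n+2,n+1) = 2(2n+1)C(2n,n)`). -/
theorem dSum_eq (n : ℕ) : dSum n = ((((2 * n).choose n : ℕ) : ℚ)) ^ 3 := by
  induction n with
  | zero => simp [dSum, dTerm]
  | succ n ih =>
    have hrec := dSum_rec n
    rw [ih] at hrec
    have hc : ((n : ℚ) + 1) * (((2 * (n + 1)).choose (n + 1) : ℕ) : ℚ) =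
        2 * (2 * (n : ℚ) + 1) * (((2 * n).choose n : ℕ) : ℚ) := by
      have := Nat.succ_mul_centralBinom_succ n
      rw [Nat.centralBinom_eq_two_mul_choose, Nat.centralBinom_eq_two_mul_choose] at this
      exact_mod_cast this
    have hn : ((n : ℚ) + 1) ^ 3 ≠ 0 := by positivity
    apply mul_left_cancel₀ hn
    rw [hrec]
    linear_combination (-(((n : ℚ) + 1) ^ 2 * (((2 * (n + 1)).choose (n + 1) : ℕ) : ℚ) ^ 2) -
      ((n : ℚ) + 1) * (((2 * (n + 1)).choose (n + 1) : ℕ) : ℚ) * (2 * (2 * (n : ℚ) + 1) * (((2 * n).choose n : ℕ) : ℚ)) -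
      (2 * (2 * (n : ℚ) + 1) * (((2 * n).choose n : ℕ) : ℚ)) ^ 2) * hc

/-- `T(n,n) = D(n)`: the inner sum of Brown–Zudilin's (7) at `k = n` is the anchor sum. -/
theorem innerT_diag (n : ℕ) : innerT n n = dSum n := by
  unfold innerT dSum
  refine Finset.sum_congr rfl fun j _ => ?_
  unfold innerTerm dTerm
  have e1 : (n + j).choose n = (n + j).choose j := Nat.choose_symm_add
  have e2 : (n + n + j).choose n = (2 * n + j).choose (n + j) := by
    rw [show n + n + j = n + (n + j) by ring, Nat.choose_symm_add, show n + (n + j) = 2 * n + j by ring]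
  rw [e1, e2]

/-! ### `U = V`: the free zeros above the diagonal, the anchor, downward induction -/

/-- `U(n,n) = V(n,n)` (both are `C(2n,n)³`). -/
theorem uSum_eq_vVal_diag (n : ℕ) : uSum n n = vVal n n := by
  rw [uSum_diag, vVal, innerT_diag, dSum_eq, Nat.choose_self]; push_cast; ring

/-- `p₀(n,k) ≠ 0` for `k < n`. -/
theorem p₀_ne_zero {n k : ℕ} (hk : k < n) : p₀ n k ≠ 0 := by
  unfold p₀
  have h1 : ((k : ℚ) - n) ≠ 0 := by
    have : (k : ℚ) < n := by exact_mod_cast hk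
    intro h; linarith
  have h2 : ((k : ℚ) + n + 1) ^ 3 ≠ 0 := by positivity
  exact mul_ne_zero h1 h2

/-- **`U(n,k) = V(n,k)` for all `k ≤ n`** (`n ≥ 1`): downward induction on `k` from the free zeros `k = n+1, n+2` and
the anchor `k = n`, using the common recurrence and `p₀ ≠ 0` below the diagonal. -/
theorem uSum_eq_vVal (n k : ℕ) (hn : 1 ≤ n) (hk : k ≤ n) : uSum n k = vVal n k := by
  have key : ∀ m, m ≤ n → uSum n (n - m) = vVal n (n - m) ∧ uSum n (n - m + 1) = vVal n (n - m + 1) := by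
    intro m
    induction m with
    | zero =>
      intro _
      refine ⟨by simpa using uSum_eq_vVal_diag n, ?_⟩
      rw [show n - 0 + 1 = n + 1 + 0 by omega, uSum_above, vVal_above]
    | succ m ih =>
      intro hm
      obtain ⟨h1, h2⟩ := ih (by omega)
      have ek1 : n - m = n - (m + 1) + 1 := by omega
      have ek2 : n - m + 1 = n - (m + 1) + 2 := by omega
      rw [ek1] at h1
      rw [ek2] at h2
      refine ⟨?_, h1⟩
      have hU := uSum_rec n (n - (m + 1)) hn
      have hV := vVal_rec n (n - (m + 1))
      have hp := p₀_ne_zero (show n - (m + 1) < n by omega)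
      have hmul : p₀ n ↑(n - (m + 1)) * (uSum n (n - (m + 1)) - vVal n (n - (m + 1))) = 0 := by
        linear_combination hU - hV - p₁ n ↑(n - (m + 1)) * h1 - p₂ n ↑(n - (m + 1)) * h2
      exact sub_eq_zero.mp ((mul_eq_zero.mp hmul).resolve_left hp)
  have := (key (n - k) (by omega)).1
  rwa [show n - (n - k) = k by omega] at this

/-! ### Back to the tree's `SA`, `SB`: the single-sum identity and D-exact on the diagonal -/

/-- `U(n,k) = C(n+k,n)·S_A(n,k)` for `k ≤ n` (the truncation-safe summand agrees with the summand of `SA` on `j ≤ n − k`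
and vanishes beyond). -/
theorem uSum_eq_SA (n k : ℕ) (hk : k ≤ n) : uSum n k = (((n + k).choose n : ℕ) : ℚ) * ((SA n k : ℕ) : ℚ) := by
  have hsub : range (n - k + 1) ⊆ range (n + 1) := fun x hx =>
    Finset.mem_range.mpr (by have := Finset.mem_range.mp hx; omega)
  have hvan : ∀ j ∈ range (n + 1), j ∉ range (n - k + 1) → uTerm n k j = 0 := by
    intro j hj hj'
    have h1 := Finset.mem_range.mp hj
    have h2 : ¬ j < n - k + 1 := fun h => hj' (Finset.mem_range.mpr h)
    unfold uTerm
    rw [Nat.choose_eq_zero_of_lt (by omega : 2 * n - j < n + k)]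
    simp
  unfold uSum
  rw [← Finset.sum_subset hsub hvan]
  unfold SA
  push_cast
  rw [Finset.mul_sum]
  refine Finset.sum_congr rfl fun j hj => ?_
  have hj' := Finset.mem_range.mp hj
  have e1 : (n + k).choose k = (n + k).choose n := by
    rw [Nat.choose_symm_add]
  have e2 : (n + k).choose (k + j) = (n + k).choose (n - j) := by
    rw [← Nat.choose_symm (by omega : n - j ≤ n + k)]; congr 1; omega
  have e3 : (2 * n - j).choose (n + k) = (2 * n - j).choose (n - k - j) := by
    rw [← Nat.choose_symm (by omega : n + k ≤ 2 * n - j)]; congr 1; omega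
  unfold uTerm
  rw [e1, e2, e3]
  ring

/-- `V(n,k) = C(n,k)·S_B(n,k)` (`SB n k` is `SymmetricRecursion.innerT n k` read in `ℕ`). -/
theorem vVal_eq_SB (n k : ℕ) : vVal n k = ((n.choose k : ℕ) : ℚ) * ((SB n k : ℕ) : ℚ) := by
  unfold vVal innerT innerTerm SB
  push_cast
  congr 1
  refine Finset.sum_congr rfl fun j _ => ?_
  ring

/-- **The single-sum identity (3.4) of fam-tele g10, PROVED**: `C(n+k,n)·S_A(n,k) = C(n,k)·S_B(n,k)` for `0 ≤ k ≤ n`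
(Whipple-free: certificates C1, relation (K), anchor C3, downward induction). -/
theorem singleSumIdentity_holds : SingleSumIdentity := by
  intro n k hk
  rcases Nat.eq_zero_or_pos n with rfl | hn
  · exact singleSumIdentity_le_four 0 (by norm_num) k hk
  · have h := uSum_eq_vVal n k hn hk
    rw [uSum_eq_SA n k hk, vVal_eq_SB] at h
    exact_mod_cast h

/-- **CONJECTURE D-exact on the diagonal, double-sum form, UNCONDITIONAL**: `Fdiag n = Q n` for every `n` — the double
binomial sum of fam-tele's Theorem 1 equals Brown–Zudilin's `Q_n` (eq. (7)).  (The remaining step to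
`dualConstantTerm (n,…,n) = Q n` is the formal coefficient extraction `dualConstantTerm (n,…,n) = Fdiag n`.) -/
theorem Fdiag_eq_Q (n : ℕ) : Fdiag n = Q n := Fdiag_eq_of_singleSum singleSumIdentity_holds n

end Summit.KontsevichZagierPeriods.Zeta5Search.DexactDiagonalWhipple
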